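import Literature.Computability.MetaComplexity.AvgCaseTallyNE
import Literature.Computability.Complexity.NPBoundedQuantifiers
import Literature.Computability.Complexity.UnaryBricks
import HarnessLib

/-!
# Hard `NP` languages without refuters (Chen–Jin–Santhanam–Williams, Thm. 1.9): the input format

Topic `Literature/Computability/MetaComplexity`. First proof file of the corrected form of
[ChenEtAl2022, Thm. 1.9, first part] (`ConstructiveSeparationsProofs.lean`:
`exists_NP_diff_P_without_PRefuter_of_not_NE_subset_ioE`): under `NE ⊄ io-E` there is a language in
`NP ∖ P` without `P`-refuters against the constant-one algorithm. This file fixes the FORMAT of the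
`NP` language `B` of the proof (the complement of the paper's `coNP` language `L` of §6, Proof of
Thm. 1.9) and proves its three structural properties; no machine is programmed (brick algebra of
`BrickAlgebra.lean`, `PlumbingBricks.lean`, `FPStringBricks.lean`, closure lemmas of
`NPClosureProofs.lean` / `NPBoundedQuantifiers.lean`).

## The format (proof device; namespace `NoRefuter`)

The data are an `NP` language `T` with a `P`-verifier `V` and witness bound `p`
(`x ∈ T ↔ ∃ w, |w| ≤ p |x| ∧ ⟨x, w⟩ ∈ V`; in the application `T` is the tally language of an `NE`
language `L'`, so that LEVEL `m` — the tally words `1ᴺ`, `2ᵐ ≤ N < 2ᵐ⁺¹` — is `L'` on `{0,1}ᵐ`), and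
a format constant `D ≥ 1`.

* `ValidW V p N w` : `|w| ≤ p N ∧ ⟨1ᴺ, w⟩ ∈ V` ("`w` is a witness of `1ᴺ ∈ T`").
* Inputs of level `m` have the CANONICAL length `canon D m = 2^{D(m+1)}`; the level of a length `n`
  is `lvl D n = log₂ n / D - 1`.
* An input is read as `z = ⟨Tab, ⟨s, pad⟩⟩` with `Tab = body [e₀, …, e_{2ᵐ-1}]` (nested pairs, `OracleCompose.body`),
  `e_j = ⟨[b_j], w_j⟩` (a claimed bit of the truth table with a claimed witness), `s = ⟨r, u⟩` a
  QUERY ("does the prefix `u` extend to a witness of `1^{|r|} ∈ T`?") and `pad` ignored.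
* `Hq V p` — the query language `{s | ∃ v, ValidW V p |fst s| (snd s ++ v)}` (in `NP`);
* `B T V p D` — **the language**: `z ∈ B` iff `|z|` is not canonical, OR some entry `j < 2ᵐ` is bad
  (`¬((b_j = 1 ∧ ValidW (2ᵐ+j) w_j) ∨ (b_j = 0 ∧ 1^{2ᵐ+j} ∉ T))`), OR `s ∈ Hq` — the complement of
  the paper's `L = {certified truth table ∧ s ∉ SAT}` with `SAT` replaced by the self-reduction
  oracle `Hq` of `T` itself (which is all Claim 1 of the printed proof uses `SAT` for).

## Main results

* `B_mem_NP` (S1); `mem_B_iff_of_tableOK` (S2: on a correctly certified table of level `m`, padded to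
  the canonical length, membership in `B` is membership of the query in `Hq`);
  `bit_iff_of_not_mem_B` (S3: a non-member of `B` of canonical length reveals level `m` of `T`).

## References

* L. Chen, C. Jin, R. Santhanam, R. Williams, *Constructive separations and their consequences*,
  FOCS 2021 / TheoretiCS 3 (2024), Thm. 1.9 and §6 (Proof of Thm. 1.9, Claim 1). [ChenEtAl2022]
* S. Arora, B. Barak, *Computational Complexity: A Modern Approach*, CUP 2009, §1.3, §2.1, §2.6.2.
-/

noncomputable section

namespace Literature.Computability.MetaComplexity

open _root_.Computability Polynomial Complexity Brick Plumb Nondeterministic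

namespace NoRefuter

/-! ### A. Tables: nested-pair lists (`OracleCompose.body`) read by `HashBricks.nthItemFn` -/

/-- Length of the nested-pair code `body [e₀, e₁, …] = ⟨e₀, ⟨e₁, ⟨…, ε⟩⟩⟩`: `Σ (2|eⱼ| + 2)`. [folklore] -/
theorem length_body (es : List (List Bool)) :
    (OracleCompose.body es).length = (es.map fun e => 2 * e.length + 2).sum := by
  induction es with
  | nil => rfl
  | cons e es ih => simp [ih]

/-- A uniform bound on the code of a list with bounded entries. [folklore] -/
theorem length_body_le (es : List (List Bool)) (b : ℕ) (h : ∀ e ∈ es, e.length ≤ b) :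
    (OracleCompose.body es).length ≤ es.length * (2 * b + 2) := by
  induction es with
  | nil => simp
  | cons e es ih =>
    have he := h e (by simp)
    have ih' := ih fun e' he' => h e' (by simp [he'])
    simp only [OracleCompose.body_cons, length_boolPair, List.length_cons]
    nlinarith

/-- **The reader reads**: `nthItemFn ⟨1ʲ, body es⟩ = es[j]` for `j < |es|`. [folklore] -/
theorem nthItemFn_body_of_lt {j : ℕ} {es : List (List Bool)} (hj : j < es.length) :
    HashBricks.nthItemFn (boolPair (ones j) (OracleCompose.body es)) = es[j] := by
  rw [HashBricks.nthItemFn_body, List.getD_eq_getElem _ _ hj]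

/-! ### B. Levels and canonical lengths -/

section Levels

variable (D : ℕ)

/-- The canonical input length of level `m`: `2^{D(m+1)}`. [folklore] -/
def canon (m : ℕ) : ℕ := 2 ^ (D * (m + 1))

/-- The level of an input length: `log₂ n / D - 1`. [folklore] -/
def lvl (n : ℕ) : ℕ := Nat.log 2 n / D - 1

variable {D}

/-- `log₂ (canon D m) = D (m+1)`. [folklore] -/
theorem log_canon (m : ℕ) : Nat.log 2 (canon D m) = D * (m + 1) := by
  rw [canon, Nat.log_pow one_lt_two]

/-- The level of a canonical length. [folklore] -/
theorem lvl_canon (hD : 0 < D) (m : ℕ) : lvl D (canon D m) = m := by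
  rw [lvl, log_canon, Nat.mul_div_cancel_left _ hD]
  rfl

/-- Canonical lengths are positive. [folklore] -/
theorem canon_pos (m : ℕ) : 0 < canon D m := Nat.two_pow_pos _

/-- `2ᵐ ≤ canon D m` (room for the `2ᵐ` entries of level `m`). [folklore] -/
theorem two_pow_le_canon (hD : 0 < D) (m : ℕ) : 2 ^ m ≤ canon D m :=
  Nat.pow_le_pow_right two_pos (by nlinarith)

/-- `2ᵐ⁺¹ ≤ canon D m`. [folklore] -/
theorem two_pow_succ_le_canon (hD : 0 < D) (m : ℕ) : 2 ^ (m + 1) ≤ canon D m :=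
  Nat.pow_le_pow_right two_pos (by nlinarith)

/-- Canonical lengths increase strictly with the level. [folklore] -/
theorem canon_strictMono (hD : 0 < D) : StrictMono (canon D) := fun a b hab =>
  Nat.pow_lt_pow_right one_lt_two (by nlinarith)

/-- Canonical lengths determine the level. [folklore] -/
theorem canon_injective (hD : 0 < D) : Function.Injective (canon D) := (canon_strictMono hD).injective

/-- `m ≤ canon D m`. [folklore] -/
theorem le_canon (hD : 0 < D) (m : ℕ) : m ≤ canon D m :=
  ((canon_strictMono hD).id_le m)

variable (D)

/-- `z ↦ 1^{log₂ |z| / D}` (`Brick.logFn`, `Plumb.divModFn`). [folklore] -/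
def qFn : List Bool → List Bool := fstF ∘ divModFn ∘ fanoutFn (fun _ => ones D) logFn

/-- `qFn D ∈ FP`. [folklore] -/
theorem qFn_mem_FP : qFn D ∈ FP :=
  comp_mem_FP fstF_mem_FP (comp_mem_FP divModFn_mem_FP (fanoutFn_mem_FP (const_mem_FP _) logFn_mem_FP))

/-- Value of `qFn`. [folklore] -/
@[simp] theorem qFn_apply (z : List Bool) : qFn D z = ones (Nat.log 2 z.length / D) := by
  simp [qFn, logFn]

/-- `z ↦ 1^{lvl D |z|}`. [folklore] -/
def lvlFn : List Bool → List Bool := List.tail ∘ qFn D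

/-- `lvlFn D ∈ FP`. [folklore] -/
theorem lvlFn_mem_FP : lvlFn D ∈ FP := comp_mem_FP PRelSigma.tail_mem_FP (qFn_mem_FP D)

/-- Value of `lvlFn`: `1^{lvl D |z|}`. [folklore] -/
@[simp] theorem lvlFn_apply (z : List Bool) : lvlFn D z = ones (lvl D z.length) := by
  simp [lvlFn, lvl, ones]

/-- The binary numeral `0^{a|x|} 1` of `2^{a|x|}` (as `AvgNE.pow2NumF`). [folklore] -/
theorem pow2NumF_eq (a : ℕ) (x : List Bool) :
    AvgNE.pow2NumF a x = List.replicate (a * x.length) false ++ [true] := by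
  simp [AvgNE.pow2NumF, onesMulFn]

/-- `encodeNat (2^{a|x|})` is the numeral `0^{a|x|} 1`. [folklore] -/
theorem encodeNat_two_pow_mul_length (a : ℕ) (x : List Bool) :
    encodeNat (2 ^ (a * x.length)) = AvgNE.pow2NumF a x := by
  rw [← AvgNE.bitsToNat_pow2NumF a x, pow2NumF_eq]
  exact encodeNat_bitsToNat (isCanonicalNum_append_true _)

/-- **The canonical-length test** `Canon D = {z | encodeNat |z| = 0^{D q} 1 ∧ q ≥ 1}`, `q = log₂|z|/D`.
[folklore] -/
def Canon : Language Bool :=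
  {z | lenBinF z = (AvgNE.pow2NumF D ∘ qFn D) z} ⊓ {z | qFn D z = (fun _ => ([] : List Bool)) z}ᶜ

/-- **The canonical-length test is in `P`.** [cite: AroraBarak2009, §1.3] -/
theorem Canon_mem_P : Canon D ∈ Classes.P :=
  inter_mem_P (setOf_apply_eq_apply_mem_P lenBinF_mem_FP (comp_mem_FP (AvgNE.pow2NumF_mem_FP D) (qFn_mem_FP D)))
    (compl_mem_P_iff.2 (setOf_apply_eq_apply_mem_P (qFn_mem_FP D) (const_mem_FP _)))

variable {D}

/-- A word of canonical length passes the test. [folklore] -/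
theorem mem_Canon_of_length_eq (hD : 0 < D) {z : List Bool} {m : ℕ} (hz : z.length = canon D m) :
    z ∈ Canon D := by
  have hq : Nat.log 2 z.length / D = m + 1 := by
    rw [hz, log_canon, Nat.mul_div_cancel_left _ hD]
  constructor
  · change lenBinF z = AvgNE.pow2NumF D (qFn D z)
    rw [lenBinF_apply, qFn_apply, hq, ← encodeNat_two_pow_mul_length, hz, canon]
    simp
  · change ¬ qFn D z = []
    rw [qFn_apply, hq]
    simp [ones]

/-- A word passing the test has the canonical length of its level. [folklore] -/
theorem length_eq_canon_of_mem_Canon {z : List Bool} (hz : z ∈ Canon D) :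
    z.length = canon D (lvl D z.length) := by
  obtain ⟨h1, h2⟩ := hz
  change lenBinF z = AvgNE.pow2NumF D (qFn D z) at h1
  change ¬ qFn D z = [] at h2
  rw [qFn_apply] at h1 h2
  have hq : 1 ≤ Nat.log 2 z.length / D := by
    rcases Nat.eq_zero_or_pos (Nat.log 2 z.length / D) with h | h
    · exact absurd (by rw [h]; rfl) h2
    · exact h
  have h3 := congrArg bitsToNat h1
  rw [lenBinF_apply, bitsToNat_encodeNat, AvgNE.bitsToNat_pow2NumF] at h3
  have h3' : z.length = 2 ^ (D * (Nat.log 2 z.length / D)) := by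
    simpa only [List.length_replicate] using h3
  rw [canon, lvl, Nat.sub_add_cancel hq]
  exact h3'

/-- `z ↦ 1^{2^{lvl |z|}}`, capped by `|z|` (no cap on a canonical length). [folklore] -/
def pow2LvlFn : List Bool → List Bool := binToUnaryFn ∘ fanoutFn id (AvgNE.pow2NumF 1 ∘ lvlFn D)

variable (D)

/-- `pow2LvlFn ∈ FP`. [folklore] -/
theorem pow2LvlFn_mem_FP : pow2LvlFn (D := D) ∈ FP :=
  comp_mem_FP binToUnaryFn_mem_FP (fanoutFn_mem_FP OracleCompose.id_mem_FP
    (comp_mem_FP (AvgNE.pow2NumF_mem_FP 1) (lvlFn_mem_FP D)))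

variable {D}

/-- Value of `pow2LvlFn` (capped binary-to-unary conversion). [folklore] -/
theorem pow2LvlFn_apply (z : List Bool) :
    pow2LvlFn (D := D) z = ones (min (2 ^ lvl D z.length) z.length) := by
  simp [pow2LvlFn, AvgNE.bitsToNat_pow2NumF]

/-- The cap: `|pow2LvlFn z| ≤ |z|`. [folklore] -/
theorem length_pow2LvlFn_le (z : List Bool) : (pow2LvlFn (D := D) z).length ≤ z.length := by
  rw [pow2LvlFn_apply]; simp

/-- On a word of canonical length of level `m`, `pow2LvlFn` is `1^{2ᵐ}`. [folklore] -/
theorem pow2LvlFn_of_length_eq (hD : 0 < D) {z : List Bool} {m : ℕ} (hz : z.length = canon D m) :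
    pow2LvlFn (D := D) z = ones (2 ^ m) := by
  rw [pow2LvlFn_apply, hz, lvl_canon hD, min_eq_left (two_pow_le_canon hD m)]

end Levels

/-! ### C. Witnesses, the query language and the language `B` -/

section Language


variable (T V : Language Bool) (p : Polynomial ℕ) (D : ℕ)

/-- `w` is a witness of `1ᴺ ∈ T`: `|w| ≤ p N ∧ ⟨1ᴺ, w⟩ ∈ V`. [cite: AroraBarak2009, Def. 2.1] -/
def ValidW (N : ℕ) (w : List Bool) : Prop := w.length ≤ p.eval N ∧ boolPair (ones N) w ∈ V

variable {T V p} in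
/-- Membership of a tally word in terms of witnesses. [cite: AroraBarak2009, Def. 2.1] -/
theorem ones_mem_iff (hver : IsPolyVerifierFor V p T) (N : ℕ) : ones N ∈ T ↔ ∃ w, ValidW V p N w := by
  rw [hver (ones N)]
  simp [ValidW, ones]

/-- **The query language** `Hq = {s | the prefix `snd s` extends to a witness of 1^{|fst s|} ∈ T}`.
[cite: ChenEtAl2022, §6 (Proof of Thm. 1.9, Claim 1: search-to-decision)] -/
def Hq : Language Bool := {s | ∃ v, ValidW V p (fstF s).length (sndF s ++ v)}

/-- The verifier of `Hq`: `⟨⟨r, u⟩, v⟩ ↦ ⟨1^{|r|}, u ++ v⟩`, tested in `LenLe p ⊓ V`. [folklore] -/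
def hqG : List Bool → List Bool :=
  fanoutFn (onesFn ∘ fstF ∘ fstF) (fun t => (sndF ∘ fstF) t ++ sndF t)

/-- `hqG ∈ FP`. [folklore] -/
theorem hqG_mem_FP : hqG ∈ FP :=
  fanoutFn_mem_FP (comp_mem_FP onesFn_mem_FP (comp_mem_FP fstF_mem_FP fstF_mem_FP))
    (append_mem_FP (comp_mem_FP sndF_mem_FP fstF_mem_FP) sndF_mem_FP)

/-- Value of `hqG` on a pair. [folklore] -/
theorem hqG_boolPair (s v : List Bool) :
    hqG (boolPair s v) = boolPair (ones (fstF s).length) (sndF s ++ v) := by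
  simp [hqG, onesFn, unaryEncodeNat_eq_replicate, ones]

variable {V} in
/-- **`Hq ∈ NP`** for `V ∈ P`. [cite: AroraBarak2009, Def. 2.1] -/
theorem Hq_mem_NP (hV : V ∈ Classes.P) : Hq V p ∈ NP := by
  refine ⟨hqG ⁻¹' (LenLe p ⊓ V), preimage_mem_P (inter_mem_P (LenLe_mem_P p) hV) hqG_mem_FP, p, fun s => ?_⟩
  have hmem : ∀ v, boolPair s v ∈ (hqG ⁻¹' (LenLe p ⊓ V) : Language Bool) ↔
      ValidW V p (fstF s).length (sndF s ++ v) := fun v => by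
    change (hqG (boolPair s v) ∈ LenLe p ∧ hqG (boolPair s v) ∈ V) ↔ _
    rw [hqG_boolPair, boolPair_mem_LenLe, List.length_replicate]
    exact Iff.rfl
  constructor
  · rintro ⟨v, hv⟩
    refine ⟨v, ?_, (hmem v).2 hv⟩
    have h1 := hv.1
    have h2 := length_fstF_sndF_le s
    rw [List.length_append] at h1
    exact le_trans (by omega) (TM2Iter.eval_mono p (show (fstF s).length ≤ s.length by omega))
  · rintro ⟨v, -, hv⟩
    exact ⟨v, (hmem v).1 hv⟩

/-! #### The matrix of the bad-entry test, on pairs `q = ⟨z, ι⟩` (`ι = 1ʲ` the entry index) -/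

/-- Entry `|ι|` of the table `fst z`. [folklore] -/
def entryQ : List Bool → List Bool := HashBricks.nthItemFn ∘ fanoutFn sndF (fstF ∘ fstF)

/-- `entryQ ∈ FP`. [folklore] -/
theorem entryQ_mem_FP : entryQ ∈ FP :=
  comp_mem_FP HashBricks.nthItemFn_mem_FP (fanoutFn_mem_FP sndF_mem_FP (comp_mem_FP fstF_mem_FP fstF_mem_FP))

/-- Value of `entryQ` on a pair. [folklore] -/
theorem entryQ_boolPair (z ι : List Bool) : entryQ (boolPair z ι) = HashBricks.nthItemFn (boolPair ι (fstF z)) := by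
  simp [entryQ]

/-- The claimed bit `fst e` and the claimed witness `snd e` of the entry. [folklore] -/
def bitQ : List Bool → List Bool := fstF ∘ entryQ

/-- See `bitQ`. [folklore] -/
def witQ : List Bool → List Bool := sndF ∘ entryQ

/-- `bitQ ∈ FP`. [folklore] -/
theorem bitQ_mem_FP : bitQ ∈ FP := comp_mem_FP fstF_mem_FP entryQ_mem_FP
/-- `witQ ∈ FP`. [folklore] -/
theorem witQ_mem_FP : witQ ∈ FP := comp_mem_FP sndF_mem_FP entryQ_mem_FP

/-- `⟨z, ι⟩ ↦ 1^{2^{lvl|z|}}` (capped). [folklore] -/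
def pow2Q : List Bool → List Bool := pow2LvlFn (D := D) ∘ fstF

/-- `pow2Q D ∈ FP`. [folklore] -/
theorem pow2Q_mem_FP : pow2Q D ∈ FP := comp_mem_FP (pow2LvlFn_mem_FP D) fstF_mem_FP

/-- `⟨z, ι⟩ ↦ 1^{2^{lvl|z|} + |ι|}`: the tally word the entry is about. [folklore] -/
def nunQ : List Bool → List Bool := fun q => pow2Q D q ++ onesFn (sndF q)

/-- `nunQ D ∈ FP`. [folklore] -/
theorem nunQ_mem_FP : nunQ D ∈ FP := append_mem_FP (pow2Q_mem_FP D) (comp_mem_FP onesFn_mem_FP sndF_mem_FP)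

/-- The index test `|ι| < 2^{lvl |z|}`. [folklore] -/
def IdxOK : Language Bool := fanoutFn (pow2Q D) sndF ⁻¹' LenLt X

/-- `IdxOK D ∈ P`. [cite: AroraBarak2009, §1.3] -/
theorem IdxOK_mem_P : IdxOK D ∈ Classes.P :=
  preimage_mem_P (LenLt_mem_P X) (fanoutFn_mem_FP (pow2Q_mem_FP D) sndF_mem_FP)

/-- The witness test of the entry: `ValidW (2^{lvl}+|ι|) (witQ q)`. [folklore] -/
def ValidL : Language Bool := (fanoutFn (nunQ D) witQ ⁻¹' LenLe p) ⊓ (fanoutFn (nunQ D) witQ ⁻¹' V)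

variable {V} in
/-- `ValidL ∈ P` for `V ∈ P`. [cite: AroraBarak2009, Def. 2.1] -/
theorem ValidL_mem_P (hV : V ∈ Classes.P) : ValidL V p D ∈ Classes.P :=
  inter_mem_P (preimage_mem_P (LenLe_mem_P p) (fanoutFn_mem_FP (nunQ_mem_FP D) witQ_mem_FP))
    (preimage_mem_P hV (fanoutFn_mem_FP (nunQ_mem_FP D) witQ_mem_FP))

/-- The membership test of the entry's tally word: `1^{2^{lvl}+|ι|} ∈ T`. [folklore] -/
def InT : Language Bool := nunQ D ⁻¹' T

variable {T} in
/-- `InT ∈ NP` for `T ∈ NP` (Karp preimage). [cite: AroraBarak2009, Thm. 2.8] -/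
theorem InT_mem_NP (hT : T ∈ NP) : InT T D ∈ NP := preimage_mem_NP hT (nunQ_mem_FP D)

/-- The claimed bit is `b`. [folklore] -/
def BitIs (b : Bool) : Language Bool := {q | bitQ q = (fun _ => [b]) q}

/-- `BitIs b ∈ P`. [cite: AroraBarak2009, §1.3] -/
theorem BitIs_mem_P (b : Bool) : BitIs b ∈ Classes.P :=
  setOf_apply_eq_apply_mem_P bitQ_mem_FP (const_mem_FP _)

/-- **The bad-entry matrix** `A = IdxOK ⊓ ((BitIs 1)ᶜ ⊔ ValidLᶜ) ⊓ ((BitIs 0)ᶜ ⊔ InT)`: the index is in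
range and the entry is NOT a correct certificate (neither a `1` with a valid witness nor a `0` of a
non-member). [cite: ChenEtAl2022, §6 (Proof of Thm. 1.9, conditions (1)–(2))] -/
def Amat : Language Bool :=
  IdxOK D ⊓ (((BitIs true)ᶜ ⊔ (ValidL V p D)ᶜ) ⊓ ((BitIs false)ᶜ ⊔ InT T D))

variable {T V} in
/-- **The bad-entry matrix is in `NP`** (closure of `NP` under `P`-intersections and `P`-unions). [cite: AroraBarak2009, Def. 2.1, Thm. 2.8] -/
theorem Amat_mem_NP (hT : T ∈ NP) (hV : V ∈ Classes.P) : Amat T V p D ∈ NP := by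
  have hKP : ∀ ⦃L₁ L₂ : Language Bool⦄, L₁ ∈ Classes.P → L₂ ∈ Classes.P → L₁ ⊓ L₂ ∈ Classes.P :=
    fun _ _ h₁ h₂ => inter_mem_P h₁ h₂
  have hKU : ∀ ⦃L₁ L₂ : Language Bool⦄, L₁ ∈ Classes.P → L₂ ∈ Classes.P → L₁ ⊔ L₂ ∈ Classes.P :=
    fun _ _ h₁ h₂ => union_mem_P h₁ h₂
  refine inter_P_mem_polyExists hKP (IdxOK_mem_P D) (inter_P_mem_polyExists hKP ?_ ?_)
  · exact union_mem_P (compl_mem_P_iff.2 (BitIs_mem_P true)) (compl_mem_P_iff.2 (ValidL_mem_P p D hV))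
  · exact union_P_mem_polyExists hKU (compl_mem_P_iff.2 (BitIs_mem_P false)) (InT_mem_NP D hT)

/-- `NP` is closed under binary union (as `Complexity.union_mem_NP`, restated to keep the imports of
this file small). [cite: AroraBarak2009, Def. 2.1] -/
theorem union_mem_NP' {L₁ L₂ : Language Bool} (h₁ : L₁ ∈ NP) (h₂ : L₂ ∈ NP) : L₁ ⊔ L₂ ∈ NP := by
  obtain ⟨V₁, hV₁, q₁, hq₁⟩ := h₁
  obtain ⟨V₂, hV₂, q₂, hq₂⟩ := h₂
  refine ⟨(LenLe q₁ ⊓ V₁) ⊔ (LenLe q₂ ⊓ V₂), union_mem_P (inter_mem_P (LenLe_mem_P q₁) hV₁)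
    (inter_mem_P (LenLe_mem_P q₂) hV₂), q₁ + q₂, fun x => ?_⟩
  change x ∈ L₁ ∨ x ∈ L₂ ↔ ∃ y, y.length ≤ (q₁ + q₂).eval x.length ∧
    ((boolPair x y ∈ LenLe q₁ ∧ boolPair x y ∈ V₁) ∨ (boolPair x y ∈ LenLe q₂ ∧ boolPair x y ∈ V₂))
  simp only [boolPair_mem_LenLe, eval_add, hq₁, hq₂]
  constructor
  · rintro (⟨y, hy, hV⟩ | ⟨y, hy, hV⟩)
    · exact ⟨y, by omega, Or.inl ⟨hy, hV⟩⟩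
    · exact ⟨y, by omega, Or.inr ⟨hy, hV⟩⟩
  · rintro ⟨y, -, (⟨hy, hV⟩ | ⟨hy, hV⟩)⟩
    · exact Or.inl ⟨y, hy, hV⟩
    · exact Or.inr ⟨y, hy, hV⟩

/-- The query slot `fst (snd z)`. [folklore] -/
def slotFn : List Bool → List Bool := fstF ∘ sndF

/-- `slotFn ∈ FP`. [folklore] -/
theorem slotFn_mem_FP : slotFn ∈ FP := comp_mem_FP fstF_mem_FP sndF_mem_FP

/-- The query slot is in `Hq`. [folklore] -/
def SlotH : Language Bool := slotFn ⁻¹' Hq V p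

/-- Membership in `SlotH`. [folklore] -/
theorem mem_SlotH (z : List Bool) : z ∈ SlotH V p ↔ slotFn z ∈ Hq V p := by
  rw [SlotH, memL_preimage]

/-- **The language `B`**: non-canonical length, OR a bad entry below `2^{lvl}`, OR the query slot in `Hq`.
This is the complement of the language `L` of [ChenEtAl2022, §6, Proof of Thm. 1.9] (conditions
(1)–(3)), with the `NP`-complete slot `s ∉ SAT` of condition (3) replaced by the self-reduction
queries `s ∉ Hq` of `T`. [cite: ChenEtAl2022, §6 (Proof of Thm. 1.9)] -/
def B : Language Bool := (Canon D)ᶜ ⊔ (bexLang X (Amat T V p D) ⊔ SlotH V p)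

variable {T V} in
/-- **(S1) `B ∈ NP`.** [cite: ChenEtAl2022, §6 (Proof of Thm. 1.9: "so L ∈ coNP")] -/
theorem B_mem_NP (hT : T ∈ NP) (hV : V ∈ Classes.P) : B T V p D ∈ NP :=
  union_P_mem_polyExists (fun _ _ h₁ h₂ => union_mem_P h₁ h₂) (compl_mem_P_iff.2 (Canon_mem_P D))
    (union_mem_NP' (NPBounded.bexLang_mem_NP X (Amat_mem_NP p D hT hV)) (preimage_mem_NP (Hq_mem_NP p hV) slotFn_mem_FP))

/-- Membership in `B`, unfolded. [folklore] -/
theorem mem_B (z : List Bool) : z ∈ B T V p D ↔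
    z ∉ Canon D ∨ (z ∈ bexLang X (Amat T V p D) ∨ slotFn z ∈ Hq V p) := by
  rw [B, PPSharpP.memL_sup, PPSharpP.memL_sup, PPSharpP.memL_compl, mem_SlotH]

/-! ### D. Semantics of `B` on inputs of canonical length -/

/-- The bit read at index `j` of an input `z`: `fst (entry j of fst z)`. [folklore] -/
def readBit (z : List Bool) (j : ℕ) : List Bool := fstF (HashBricks.nthItemFn (boolPair (ones j) (fstF z)))

/-- The witness read at index `j` of an input `z`: `snd (entry j of fst z)`. [folklore] -/
def readWit (z : List Bool) (j : ℕ) : List Bool := sndF (HashBricks.nthItemFn (boolPair (ones j) (fstF z)))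

/-- `onesFn 1ʲ = 1ʲ`. [folklore] -/
theorem onesFn_ones (j : ℕ) : onesFn (ones j) = ones j := by
  simp [onesFn, unaryEncodeNat_eq_replicate]

section Eval

variable {T V p D}

/-! Unfolding lemmas (definitional). -/

/-- Membership in `IdxOK`, unfolded. [folklore] -/
theorem mem_IdxOK (q : List Bool) : q ∈ IdxOK D ↔ fanoutFn (pow2Q D) sndF q ∈ LenLt X := by
  rw [IdxOK, memL_preimage]

/-- Membership in `ValidL`, unfolded. [folklore] -/
theorem mem_ValidL (q : List Bool) : q ∈ ValidL V p D ↔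
    (fanoutFn (nunQ D) witQ q ∈ LenLe p ∧ fanoutFn (nunQ D) witQ q ∈ V) := by
  rw [ValidL, Language.mem_inf, memL_preimage, memL_preimage]

/-- Membership in `InT`, unfolded. [folklore] -/
theorem mem_InT (q : List Bool) : q ∈ InT T D ↔ nunQ D q ∈ T := by
  rw [InT, memL_preimage]

/-- Membership in `BitIs b`, unfolded. [folklore] -/
theorem mem_BitIs (b : Bool) (q : List Bool) : q ∈ BitIs b ↔ bitQ q = [b] := Iff.rfl

/-- Membership in the bad-entry matrix, unfolded. [folklore] -/
theorem mem_Amat (q : List Bool) : q ∈ Amat T V p D ↔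
    q ∈ IdxOK D ∧ (q ∉ BitIs true ∨ q ∉ ValidL V p D) ∧ (q ∉ BitIs false ∨ q ∈ InT T D) := by
  rw [Amat, Language.mem_inf, Language.mem_inf, PPSharpP.memL_sup, PPSharpP.memL_sup, PPSharpP.memL_compl, PPSharpP.memL_compl, PPSharpP.memL_compl]

/-! Values on an index pair `⟨z, 1ʲ⟩` over an input `z` of canonical length. -/

variable {z : List Bool} {m : ℕ}

/-- Value of `pow2Q` on an index pair over an input of canonical length. [folklore] -/
theorem pow2Q_eval (hD : 0 < D) (hz : z.length = canon D m) (j : ℕ) :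
    pow2Q D (boolPair z (ones j)) = ones (2 ^ m) := by
  simp only [pow2Q, Function.comp_apply, fstF_boolPair, pow2LvlFn_of_length_eq hD hz]

/-- Value of `nunQ` on an index pair over an input of canonical length: `1^{2ᵐ+j}`. [folklore] -/
theorem nunQ_eval (hD : 0 < D) (hz : z.length = canon D m) (j : ℕ) :
    nunQ D (boolPair z (ones j)) = ones (2 ^ m + j) := by
  rw [nunQ, pow2Q_eval hD hz, sndF_boolPair, onesFn_ones, Com.ones_append]

/-- `bitQ ⟨z, 1ʲ⟩ = readBit z j`. [folklore] -/
theorem bitQ_eval (z : List Bool) (j : ℕ) : bitQ (boolPair z (ones j)) = readBit z j := by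
  simp [bitQ, entryQ, readBit]

/-- `witQ ⟨z, 1ʲ⟩ = readWit z j`. [folklore] -/
theorem witQ_eval (z : List Bool) (j : ℕ) : witQ (boolPair z (ones j)) = readWit z j := by
  simp [witQ, entryQ, readWit]

/-- The index test holds iff `j < 2ᵐ`. [folklore] -/
theorem mem_IdxOK_iff (hD : 0 < D) (hz : z.length = canon D m) (j : ℕ) :
    boolPair z (ones j) ∈ IdxOK D ↔ j < 2 ^ m := by
  rw [mem_IdxOK, fanoutFn_apply, pow2Q_eval hD hz, sndF_boolPair, boolPair_mem_LenLt]
  simp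

/-- The witness test holds iff the witness read at `j` is valid for `1^{2ᵐ+j}`. [folklore] -/
theorem mem_ValidL_iff (hD : 0 < D) (hz : z.length = canon D m) (j : ℕ) :
    boolPair z (ones j) ∈ ValidL V p D ↔ ValidW V p (2 ^ m + j) (readWit z j) := by
  rw [mem_ValidL, fanoutFn_apply, nunQ_eval hD hz, witQ_eval, boolPair_mem_LenLe, List.length_replicate]
  exact Iff.rfl

/-- The membership test holds iff `1^{2ᵐ+j} ∈ T`. [folklore] -/
theorem mem_InT_iff (hD : 0 < D) (hz : z.length = canon D m) (j : ℕ) :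
    boolPair z (ones j) ∈ InT T D ↔ ones (2 ^ m + j) ∈ T := by
  rw [mem_InT, nunQ_eval hD hz]

/-- The bit test holds iff the bit read at `j` is `[b]`. [folklore] -/
theorem mem_BitIs_iff (b : Bool) (z : List Bool) (j : ℕ) : boolPair z (ones j) ∈ BitIs b ↔ readBit z j = [b] := by
  rw [mem_BitIs, bitQ_eval]

/-- Membership of an index pair in the bad-entry matrix, unfolded. [folklore] -/
theorem mem_Amat_iff (hD : 0 < D) (hz : z.length = canon D m) (j : ℕ) : boolPair z (ones j) ∈ Amat T V p D ↔
    j < 2 ^ m ∧ (readBit z j ≠ [true] ∨ ¬ ValidW V p (2 ^ m + j) (readWit z j)) ∧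
      (readBit z j ≠ [false] ∨ ones (2 ^ m + j) ∈ T) := by
  rw [mem_Amat, mem_IdxOK_iff hD hz, mem_BitIs_iff, mem_BitIs_iff, mem_ValidL_iff hD hz, mem_InT_iff hD hz]

end Eval

variable {T V p D}

/-- **(S3) A non-member of `B` of canonical length reveals its level of `T`**: its bits read
`[1^{2ᵐ+j} ∈ T]` for all `j < 2ᵐ`. [cite: ChenEtAl2022, §6 (Proof of Thm. 1.9: "every input accepted by L must reveal the truth table of L'")] -/
theorem readBit_iff_of_not_mem_B (hD : 0 < D) (hver : IsPolyVerifierFor V p T) {z : List Bool} {m : ℕ}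
    (hz : z.length = canon D m) (hB : z ∉ B T V p D) {j : ℕ} (hj : j < 2 ^ m) :
    readBit z j = [true] ↔ ones (2 ^ m + j) ∈ T := by
  have hq : boolPair z (ones j) ∉ Amat T V p D := by
    intro h
    refine hB ((mem_B _ _ _ _ _).2 (Or.inr (Or.inl ⟨j, ?_, h⟩)))
    rw [eval_X, hz]
    exact hj.trans_le (two_pow_le_canon hD m)
  rw [mem_Amat_iff hD hz] at hq
  by_cases hb : readBit z j = [true]
  · simp only [hb, true_iff]
    have hv : ValidW V p (2 ^ m + j) (readWit z j) := by
      by_contra hv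
      exact hq ⟨hj, Or.inr hv, Or.inl (by rw [hb]; simp)⟩
    exact (ones_mem_iff hver _).2 ⟨_, hv⟩
  · simp only [hb, false_iff]
    intro hT
    exact hq ⟨hj, Or.inl hb, Or.inr hT⟩

/-- **A correctly certified table of level `m`**: `2ᵐ` entries `⟨[b_j], w_j⟩`, the ones carrying valid
witnesses and the zeros sitting at non-members. [cite: ChenEtAl2022, §6 (Proof of Thm. 1.9, conditions (1)–(2))] -/
def TableOK (V : Language Bool) (p : Polynomial ℕ) (m : ℕ) (es : List (List Bool)) : Prop :=
  es.length = 2 ^ m ∧ ∀ j (hj : j < es.length), ∃ (b : Bool) (w : List Bool), es[j] = boolPair [b] w ∧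
    (b = true → ValidW V p (2 ^ m + j) w) ∧ (b = false → ∀ w', ¬ ValidW V p (2 ^ m + j) w')

/-- The bit read at `j < |es|` of an input with table `body es` is `fst es[j]`. [folklore] -/
theorem readBit_body {es : List (List Bool)} {j : ℕ} (hj : j < es.length) (s pad : List Bool) :
    readBit (boolPair (OracleCompose.body es) (boolPair s pad)) j = fstF es[j] := by
  rw [readBit, fstF_boolPair, nthItemFn_body_of_lt hj]

/-- The witness read at `j < |es|` of an input with table `body es` is `snd es[j]`. [folklore] -/
theorem readWit_body {es : List (List Bool)} {j : ℕ} (hj : j < es.length) (s pad : List Bool) :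
    readWit (boolPair (OracleCompose.body es) (boolPair s pad)) j = sndF es[j] := by
  rw [readWit, fstF_boolPair, nthItemFn_body_of_lt hj]

/-- **(S2) On a correctly certified table padded to the canonical length, membership in `B` is
membership of the query in `Hq`.** [cite: ChenEtAl2022, §6 (Proof of Thm. 1.9, Claim 1: "use L̄(t, w, ·) as a SAT solver")] -/
theorem mem_B_iff_of_tableOK (hD : 0 < D) (hver : IsPolyVerifierFor V p T) {m : ℕ} {es : List (List Bool)}
    (hes : TableOK V p m es) (s pad : List Bool)
    (hz : (boolPair (OracleCompose.body es) (boolPair s pad)).length = canon D m) :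
    boolPair (OracleCompose.body es) (boolPair s pad) ∈ B T V p D ↔ s ∈ Hq V p := by
  rw [mem_B]
  have hslot : slotFn (boolPair (OracleCompose.body es) (boolPair s pad)) = s := by simp [slotFn]
  rw [hslot]
  have hcan : boolPair (OracleCompose.body es) (boolPair s pad) ∈ Canon D := mem_Canon_of_length_eq hD hz
  have hbex : boolPair (OracleCompose.body es) (boolPair s pad) ∉ bexLang X (Amat T V p D) := by
    rintro ⟨i, -, hi⟩
    rw [mem_Amat_iff hD hz] at hi
    obtain ⟨hi, h1, h2⟩ := hi
    have hi' : i < es.length := by rw [hes.1]; exact hi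
    rw [readBit_body hi', readWit_body hi'] at h1
    rw [readBit_body hi'] at h2
    obtain ⟨b, w, he, hbt, hbf⟩ := hes.2 i hi'
    simp only [he, fstF_boolPair, sndF_boolPair] at h1 h2
    cases b with
    | true =>
      rcases h1 with h1 | h1
      · exact h1 rfl
      · exact h1 (hbt rfl)
    | false =>
      rcases h2 with h2 | h2
      · exact h2 rfl
      · obtain ⟨w', hw'⟩ := (ones_mem_iff hver _).1 h2
        exact hbf rfl w' hw'
  simp only [hcan, not_true_eq_false, false_or, hbex]

/-- **(S4) A correctly certified table reads as the truth table of its level**: bit `j` is `[1]` iff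
`1^{2ᵐ+j} ∈ T`. [cite: ChenEtAl2022, §6 (Proof of Thm. 1.9, conditions (1)–(2))] -/
theorem readBit_iff_of_tableOK (hver : IsPolyVerifierFor V p T) {m : ℕ} {es : List (List Bool)}
    (hes : TableOK V p m es) (s pad : List Bool) {j : ℕ} (hj : j < 2 ^ m) :
    readBit (boolPair (OracleCompose.body es) (boolPair s pad)) j = [true] ↔ ones (2 ^ m + j) ∈ T := by
  have hj' : j < es.length := by rw [hes.1]; exact hj
  obtain ⟨b, w, he, hbt, hbf⟩ := hes.2 j hj'
  rw [readBit_body hj', he, fstF_boolPair, ones_mem_iff hver]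
  cases b with
  | true => simpa using ⟨w, hbt rfl⟩
  | false =>
    simp only [List.cons.injEq, Bool.false_eq_true, and_true, false_iff, not_exists]
    exact hbf rfl

end Language

end NoRefuter

end Literature.Computability.MetaComplexity
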